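import Mathlib
import HarnessLib

/-!
# The weighted fibre count behind Lemma 12.5.1: a stable norm fibre re-parametrised by a system of Cartan representatives (pure group combinatorics)

Topic `GroupTheory`; namespace `Literature.GroupTheory.StableFibre`.  THEOREMS ONLY (no definition ∕ instance ∕ notation ∕ named fact ∕ `sorry`); Mathlib only.
Cell `pub/hodgecm-mathlib`, crux H413 = `stmt-HodgeConjecture-24833` (lane `--supports`, count-neutral); seat F0P3-p02 (g23), ROAD «UP-TR» (holder), brick **(N5) CLAIM-P** of
`F0/P3/F0P3-p02/g23/ROAD-UP-TR.v2.F0P3p02g23.md` §A (A-2) — in ABSTRACT form (two groups, three relations, finite data), so that the concrete `U(3) ∕ U(2) × U(1)` instantiation is one `exact`.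

THE PRINT.  [Rogawski1990 §12.5 p. 182]: «the number of `ν ∈ 𝔇(T∕F)` such that `T^ν` is conjugate to `T` is equal to `|Ω(T,G)|⁻¹|Ω_F(T,G)|`», and Lemma 12.5.1 p. 183: the value of `α^G`
at `γ^δ` is a sum over the cosets `Ω_F(T,H)∖Ω_F(T,G)`.  Both are instances of ONE counting identity which needs no Weyl-group VALUE: if a finite system `SH` of «Cartan» subgroups of
`H` is complete and irredundant for the conjugacy classes of regular elements, if the conjugates of a regular `s` inside its own member `T` number `idx T` (the Weyl index — a TORSOR
count), if the stable class of a regular `s ∈ T` consists of `m T` conjugacy classes, and if each member `T` carries finitely many «embeddings» `ψ_{T,i} : H → G` such that every norm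
partner `g` of a regular `s ∈ T` is conjugate to EXACTLY ONE `ψ_{T,i}(s)`, then for every `g`, every transversal `Q` of the stable fibre `{q regular ∣ R q g}` and every stable function `F`,
  `Σ_{q ∈ Q} F(q) = Σ_{T ∈ SH} (idx T)⁻¹ (m T)⁻¹ Σ_i Σ_{s ∈ T regular, ψ_{T,i}(s) ∼ g} F(s)`     (`weighted_fibre_sum_eq`).
The weights are FORCED: over the fibre of `q` the triples `(T, i, s)` are `⊔_{c ⊂ st(q)} (T_c ∩ c)`, `#(T_c ∩ c) = idx T_c`, `m T_c = #{c ⊂ st(q)}`.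
HONEST LABEL: count-neutral helper; closes no organ.  HC_CM is proved only modulo the 7 printed citations (2 remaining named inputs: hLiu418 = `stmt-HodgeConjecture-24832`,
h413 = `stmt-HodgeConjecture-24833`) until rung 0 closes.

## References
* [Rogawski1990] J. D. Rogawski, *Automorphic Representations of Unitary Groups in Three Variables*, Ann. of Math. Stud. 123 (1990), §3.5–3.6 pp. 28–31 (`Ω(T,G)`, `Ω_F(T,G)`,
  `𝔇(T∕F)`), §12.5 pp. 182–183 (the count quoted above; Lemma 12.5.1).
* [LanglandsShelstad1987] R. P. Langlands, D. Shelstad, *On the definition of transfer factors*, Math. Ann. 278 (1987), §1.3 (stable classes as unions of conjugacy classes).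
-/

set_option autoImplicit false

open Finset

namespace Literature.GroupTheory.StableFibre

variable {G H : Type*} [Group G] [Group H]

/-! ## §1 Transversals of a «stable class» by conjugacy classes have a well-defined size -/

/-- Two finite transversals of the conjugacy classes inside the same `st`-class have the same cardinality (for ANY relation `st`: only the transversal axioms are used).
[cite: LanglandsShelstad1987, §1.3] -/
theorem card_eq_of_transversals (st : H → H → Prop) {q : H} {C C' : Finset H}
    (hC : ∀ x ∈ C, st q x) (hCinj : ∀ x ∈ C, ∀ y ∈ C, IsConj x y → x = y) (hCexh : ∀ y, st q y → ∃ x ∈ C, IsConj y x)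
    (hC' : ∀ x ∈ C', st q x) (hC'inj : ∀ x ∈ C', ∀ y ∈ C', IsConj x y → x = y) (hC'exh : ∀ y, st q y → ∃ x ∈ C', IsConj y x) :
    C.card = C'.card := by
  classical
  -- the matching `x ↦ the element of C' conjugate to x`
  have key : ∀ x ∈ C, ∃ x' ∈ C', IsConj x x' := fun x hx => hC'exh x (hC x hx)
  choose! φ hφmem hφconj using key
  refine Finset.card_bij (fun x hx => φ x) (fun x hx => hφmem x hx) (fun x₁ hx₁ x₂ hx₂ h => ?_) (fun x' hx' => ?_)
  · exact hCinj x₁ hx₁ x₂ hx₂ ((hφconj x₁ hx₁).trans (h ▸ (hφconj x₂ hx₂).symm))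
  · obtain ⟨x, hx, hxx'⟩ := hCexh x' (hC' x' hx')
    exact ⟨x, hx, hC'inj _ (hφmem x hx) _ hx' ((hφconj x hx).symm.trans hxx'.symm) ⟩

/-! ## §2 The weighted fibre count -/

/-- **THE WEIGHTED FIBRE COUNT.**  Setting: `st` («stable conjugacy», an equivalence relation on `H` containing conjugacy), `reg` («regular», `st`-invariant), `R` («norm pair», a
relation `H → G → Prop` invariant under `st` on the left and under conjugacy on the right); a finite system `SH` of subgroups of `H`, COMPLETE (`hcomplete`: every regular element
is conjugate into a member) and IRREDUNDANT (`hirred`: a regular element of one member conjugate to an element of another forces equality); the TORSOR count `htorsor` (the conjugates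
of a regular `s ∈ T` inside `T` form a finite set of size `idx T`); the CLASS count `hclasses` (the `st`-class of a regular `s ∈ T` has a transversal by conjugacy classes of size
`m T`); EMBEDDINGS `ψ T i : H → G`, `i : Fin (n T)`, with `R s (ψ T i s)` (`hψR`) and, for every norm partner `g` of a regular `s ∈ T`, EXACTLY ONE `i` with `ψ T i s ∼ g` (`hψuniq`).
Conclusion: for every `g : G`, every transversal `Q` of the stable fibre `{q ∣ reg q ∧ R q g}` (`hQ`, `hQinj`, `hQexh`), the finite fibres `fib T i = {x ∈ T ∣ reg x ∧ ψ T i x ∼ g}`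
(`hfib`) and every `st`-invariant `F : H → ℂ`:
`Σ_{q ∈ Q} F q = Σ_{T ∈ SH} (idx T)⁻¹ · (m T)⁻¹ · Σ_i Σ_{x ∈ fib T i} F x`.  [cite: Rogawski1990, §12.5 Lemma 12.5.1 p. 183] -/
theorem weighted_fibre_sum_eq
    (st : H → H → Prop) (hrefl : ∀ a, st a a) (hsymm : ∀ a b, st a b → st b a) (htrans : ∀ a b c, st a b → st b c → st a c)
    (hconj : ∀ a b : H, IsConj a b → st a b)
    (reg : H → Prop) (hreg : ∀ a b, st a b → reg a → reg b)
    (R : H → G → Prop) (hRst : ∀ a b g, st a b → R a g → R b g) (hRconj : ∀ a (g g' : G), IsConj g g' → R a g → R a g')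
    (SH : Finset (Subgroup H)) (idx m n : Subgroup H → ℕ) (ψ : (T : Subgroup H) → Fin (n T) → H → G)
    (hcomplete : ∀ h, reg h → ∃ T ∈ SH, ∃ s ∈ T, IsConj h s)
    (hirred : ∀ T ∈ SH, ∀ T' ∈ SH, ∀ s ∈ T, ∀ s' ∈ T', reg s → IsConj s s' → T = T')
    (htorsor : ∀ T ∈ SH, ∀ s ∈ T, reg s → ∃ A : Finset H, (∀ x, x ∈ A ↔ x ∈ T ∧ IsConj s x) ∧ A.card = idx T)
    (hclasses : ∀ T ∈ SH, ∀ s ∈ T, reg s →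
      ∃ C : Finset H, (∀ x ∈ C, st s x) ∧ (∀ x ∈ C, ∀ y ∈ C, IsConj x y → x = y) ∧ (∀ y, st s y → ∃ x ∈ C, IsConj y x) ∧ C.card = m T)
    (hψR : ∀ T ∈ SH, ∀ (i : Fin (n T)), ∀ s ∈ T, reg s → R s (ψ T i s))
    (hψuniq : ∀ T ∈ SH, ∀ s ∈ T, reg s → ∀ g, R s g → ∃! i : Fin (n T), IsConj (ψ T i s) g)
    (g : G) (Q : Finset H) (hQ : ∀ q ∈ Q, reg q ∧ R q g) (hQinj : ∀ q ∈ Q, ∀ q' ∈ Q, st q q' → q = q')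
    (hQexh : ∀ a, reg a → R a g → ∃ q ∈ Q, st a q)
    (fib : (T : Subgroup H) → Fin (n T) → Finset H) (hfib : ∀ T ∈ SH, ∀ (i : Fin (n T)), ∀ x, x ∈ fib T i ↔ x ∈ T ∧ reg x ∧ IsConj (ψ T i x) g)
    (F : H → ℂ) (hF : ∀ a b, st a b → F a = F b) :
    ∑ q ∈ Q, F q = ∑ T ∈ SH, ((idx T : ℂ)⁻¹ * ((m T : ℂ))⁻¹) * ∑ i : Fin (n T), ∑ x ∈ fib T i, F x := by
  classical
  -- §a  For `T ∈ SH`: the union `A T` of the fibres is `{x ∈ T | reg x ∧ R x g}` (disjoint union over `i` by `hψuniq`).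
  have hmemA : ∀ T ∈ SH, ∀ x, x ∈ (Finset.univ : Finset (Fin (n T))).biUnion (fib T) ↔ x ∈ T ∧ reg x ∧ R x g := by
    intro T hT x
    rw [Finset.mem_biUnion]
    constructor
    · rintro ⟨i, -, hx⟩
      obtain ⟨hxT, hxr, hxc⟩ := (hfib T hT i x).1 hx
      exact ⟨hxT, hxr, hRconj x _ _ hxc (hψR T hT i x hxT hxr)⟩
    · rintro ⟨hxT, hxr, hxR⟩
      obtain ⟨i, hi, -⟩ := hψuniq T hT x hxT hxr g hxR
      exact ⟨i, Finset.mem_univ i, (hfib T hT i x).2 ⟨hxT, hxr, hi⟩⟩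
  have hdisj : ∀ T ∈ SH, Set.PairwiseDisjoint (↑(Finset.univ : Finset (Fin (n T)))) (fib T) := by
    intro T hT i _ j _ hij
    rw [Function.onFun, Finset.disjoint_left]
    intro x hxi hxj
    obtain ⟨hxT, hxr, hci⟩ := (hfib T hT i x).1 hxi
    obtain ⟨-, -, hcj⟩ := (hfib T hT j x).1 hxj
    obtain ⟨k, -, hk⟩ := hψuniq T hT x hxT hxr g (hRconj x _ _ hci (hψR T hT i x hxT hxr))
    exact hij ((hk i hci).trans (hk j hcj).symm)
  have hsumA : ∀ T ∈ SH, ∑ i : Fin (n T), ∑ x ∈ fib T i, F x = ∑ x ∈ (Finset.univ : Finset (Fin (n T))).biUnion (fib T), F x :=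
    fun T hT => (Finset.sum_biUnion (hdisj T hT)).symm
  -- §b  Partition `A T` along the transversal `Q`: every `x ∈ A T` is `st`-related to exactly one `q ∈ Q`, and `F x = F q` there.
  have hsumQ : ∀ T ∈ SH, ∑ x ∈ (Finset.univ : Finset (Fin (n T))).biUnion (fib T), F x =
      ∑ q ∈ Q, F q * ((((Finset.univ : Finset (Fin (n T))).biUnion (fib T)).filter (fun x => st x q)).card : ℂ) := by
    intro T hT
    set A := (Finset.univ : Finset (Fin (n T))).biUnion (fib T) with hA
    have hone : ∀ x ∈ A, (Q.filter (fun q => st x q)).card = 1 := by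
      intro x hx
      obtain ⟨-, hxr, hxR⟩ := (hmemA T hT x).1 hx
      obtain ⟨q, hq, hxq⟩ := hQexh x hxr hxR
      rw [Finset.card_eq_one]
      refine ⟨q, Finset.eq_singleton_iff_unique_mem.2 ⟨Finset.mem_filter.2 ⟨hq, hxq⟩, fun q' hq' => ?_⟩⟩
      obtain ⟨hq'Q, hxq'⟩ := Finset.mem_filter.1 hq'
      exact hQinj q' hq'Q q hq (htrans _ _ _ (hsymm _ _ hxq') hxq)
    calc ∑ x ∈ A, F x = ∑ x ∈ A, ∑ q ∈ Q.filter (fun q => st x q), F x := by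
            refine Finset.sum_congr rfl fun x hx => ?_
            rw [Finset.sum_const, hone x hx, one_smul]
      _ = ∑ x ∈ A, ∑ q ∈ Q, if st x q then F x else 0 := by
            refine Finset.sum_congr rfl fun x _ => ?_
            rw [Finset.sum_filter]
      _ = ∑ q ∈ Q, ∑ x ∈ A, if st x q then F x else 0 := Finset.sum_comm
      _ = ∑ q ∈ Q, ∑ x ∈ A.filter (fun x => st x q), F q := by
            refine Finset.sum_congr rfl fun q _ => ?_
            rw [Finset.sum_filter]
            refine Finset.sum_congr rfl fun x _ => ?_
            by_cases h : st x q
            · rw [if_pos h, if_pos h, hF x q h]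
            · rw [if_neg h, if_neg h]
      _ = ∑ q ∈ Q, F q * ((A.filter (fun x => st x q)).card : ℂ) := by
            refine Finset.sum_congr rfl fun q _ => ?_
            rw [Finset.sum_const, nsmul_eq_mul, mul_comm]
  -- §c  THE COUNT: for `q ∈ Q`, `Σ_T (idx T)⁻¹ (m T)⁻¹ · #{x ∈ A T | st x q} = 1`.
  have hcount : ∀ q ∈ Q, ∑ T ∈ SH, ((idx T : ℂ)⁻¹ * ((m T : ℂ))⁻¹) *
      ((((Finset.univ : Finset (Fin (n T))).biUnion (fib T)).filter (fun x => st x q)).card : ℂ) = 1 := by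
    intro q hq
    obtain ⟨hqr, hqR⟩ := hQ q hq
    -- a member `T₀ ∋ s₀ ∼ q` and a class transversal `C` of `st(q)`
    obtain ⟨T₀, hT₀, s₀, hs₀, hqs₀⟩ := hcomplete q hqr
    have hst₀ : st q s₀ := hconj _ _ hqs₀
    obtain ⟨C, hCst, hCinj, hCexh, hCcard⟩ := hclasses T₀ hT₀ s₀ hs₀ (hreg _ _ hst₀ hqr)
    have hCst' : ∀ x ∈ C, st q x := fun x hx => htrans _ _ _ hst₀ (hCst x hx)
    have hCexh' : ∀ y, st q y → ∃ x ∈ C, IsConj y x := fun y hy => hCexh y (htrans _ _ _ (hsymm _ _ hst₀) hy)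
    -- for each class representative `c ∈ C`: its member `Tc c ∋ sc c ∼ c`
    have hcreg : ∀ c ∈ C, reg c := fun c hc => hreg _ _ (hCst' c hc) hqr
    have key : ∀ c ∈ C, ∃ T ∈ SH, ∃ s ∈ T, IsConj c s := fun c hc => hcomplete c (hcreg c hc)
    choose! Tc hTc sc hsc hcsc using key
    -- the filtered set `{x ∈ A T | st x q}` is `{x ∈ T | st q x}` and splits along `C`
    have hmemF : ∀ T ∈ SH, ∀ x, x ∈ ((Finset.univ : Finset (Fin (n T))).biUnion (fib T)).filter (fun x => st x q) ↔ x ∈ T ∧ st q x := by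
      intro T hT x
      rw [Finset.mem_filter, hmemA T hT]
      constructor
      · rintro ⟨⟨hxT, -, -⟩, hxq⟩; exact ⟨hxT, hsymm _ _ hxq⟩
      · rintro ⟨hxT, hqx⟩
        exact ⟨⟨hxT, hreg _ _ hqx hqr, hRst _ _ _ hqx hqR⟩, hsymm _ _ hqx⟩
    -- count of `{x ∈ T | st q x}` = Σ_{c ∈ C, Tc c = T} idx T
    have hcardT : ∀ T ∈ SH, ((((Finset.univ : Finset (Fin (n T))).biUnion (fib T)).filter (fun x => st x q)).card : ℂ) =
        ∑ c ∈ C.filter (fun c => Tc c = T), (idx T : ℂ) := by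
      intro T hT
      -- the torsor sets `B c = {x ∈ T | IsConj (sc c) x}` for `c` with `Tc c = T`
      have hB : ∀ c ∈ C.filter (fun c => Tc c = T), ∃ B : Finset H, (∀ x, x ∈ B ↔ x ∈ T ∧ IsConj (sc c) x) ∧ B.card = idx T := by
        intro c hc
        obtain ⟨hcC, hcT⟩ := Finset.mem_filter.1 hc
        have := htorsor (Tc c) (hTc c hcC) (sc c) (hsc c hcC) (hreg _ _ (hconj _ _ (hcsc c hcC)) (hcreg c hcC))
        rw [hcT] at this
        exact this
      choose! B hBmem hBcard using hB
      have hunion : ((Finset.univ : Finset (Fin (n T))).biUnion (fib T)).filter (fun x => st x q) = (C.filter (fun c => Tc c = T)).biUnion B := by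
        ext x
        rw [hmemF T hT, Finset.mem_biUnion]
        constructor
        · rintro ⟨hxT, hqx⟩
          obtain ⟨c, hcC, hxc⟩ := hCexh' x hqx
          have hxsc : IsConj x (sc c) := hxc.trans (hcsc c hcC)
          have hTcT : Tc c = T :=
            (hirred T hT (Tc c) (hTc c hcC) x hxT (sc c) (hsc c hcC) (hreg _ _ hqx hqr) hxsc).symm
          have hc' : c ∈ C.filter (fun c => Tc c = T) := Finset.mem_filter.2 ⟨hcC, hTcT⟩
          exact ⟨c, hc', (hBmem c hc' x).2 ⟨hxT, hxsc.symm⟩⟩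
        · rintro ⟨c, hc', hxB⟩
          obtain ⟨hcC, -⟩ := Finset.mem_filter.1 hc'
          obtain ⟨hxT, hscx⟩ := (hBmem c hc' x).1 hxB
          exact ⟨hxT, htrans _ _ _ (hCst' c hcC) (hconj _ _ ((hcsc c hcC).trans hscx))⟩
      have hBdisj : Set.PairwiseDisjoint (↑(C.filter (fun c => Tc c = T))) B := by
        intro c hc c' hc' hcc'
        rw [Function.onFun, Finset.disjoint_left]
        intro x hx hx'
        obtain ⟨hcC, -⟩ := Finset.mem_filter.1 (Finset.mem_coe.1 hc)
        obtain ⟨hc'C, -⟩ := Finset.mem_filter.1 (Finset.mem_coe.1 hc')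
        obtain ⟨-, h1⟩ := (hBmem c hc x).1 hx
        obtain ⟨-, h2⟩ := (hBmem c' hc' x).1 hx'
        exact hcc' (hCinj c hcC c' hc'C (((hcsc c hcC).trans (h1.trans h2.symm)).trans (hcsc c' hc'C).symm))
      rw [hunion, Finset.card_biUnion hBdisj, Nat.cast_sum]
      exact Finset.sum_congr rfl fun c hc => by rw [hBcard c hc]
    -- `m (Tc c) = C.card` for every `c ∈ C` (two transversals of the same stable class)
    have hmC : ∀ c ∈ C, m (Tc c) = C.card := by
      intro c hcC
      obtain ⟨C', hC'st, hC'inj, hC'exh, hC'card⟩ :=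
        hclasses (Tc c) (hTc c hcC) (sc c) (hsc c hcC) (hreg _ _ (hconj _ _ (hcsc c hcC)) (hcreg c hcC))
      have hqsc : st q (sc c) := htrans _ _ _ (hCst' c hcC) (hconj _ _ (hcsc c hcC))
      rw [← hC'card]
      exact (card_eq_of_transversals st hCst' hCinj hCexh'
        (fun x hx => htrans _ _ _ hqsc (hC'st x hx)) hC'inj (fun y hy => hC'exh y (htrans _ _ _ (hsymm _ _ hqsc) hy))).symm
    have hCpos : 0 < C.card := by
      obtain ⟨x, hx, -⟩ := hCexh' q (hrefl q)
      exact Finset.card_pos.2 ⟨x, hx⟩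
    have hidx : ∀ c ∈ C, idx (Tc c) ≠ 0 := by
      intro c hcC
      obtain ⟨A, hA, hAcard⟩ := htorsor (Tc c) (hTc c hcC) (sc c) (hsc c hcC) (hreg _ _ (hconj _ _ (hcsc c hcC)) (hcreg c hcC))
      rw [← hAcard]
      exact (Finset.card_pos.2 ⟨sc c, (hA _).2 ⟨hsc c hcC, IsConj.refl _⟩⟩).ne'
    -- assemble: Σ_T w_T · Σ_{c : Tc c = T} idx T = Σ_{c ∈ C} w_{Tc c} idx (Tc c) = Σ_{c ∈ C} (C.card)⁻¹ = 1
    calc ∑ T ∈ SH, ((idx T : ℂ)⁻¹ * ((m T : ℂ))⁻¹) *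
          ((((Finset.univ : Finset (Fin (n T))).biUnion (fib T)).filter (fun x => st x q)).card : ℂ)
        = ∑ T ∈ SH, ∑ c ∈ C.filter (fun c => Tc c = T), ((idx T : ℂ)⁻¹ * ((m T : ℂ))⁻¹) * (idx T : ℂ) := by
            refine Finset.sum_congr rfl fun T hT => ?_
            rw [hcardT T hT, Finset.mul_sum]
      _ = ∑ T ∈ SH, ∑ c ∈ C, if Tc c = T then ((idx T : ℂ)⁻¹ * ((m T : ℂ))⁻¹) * (idx T : ℂ) else 0 := by
            refine Finset.sum_congr rfl fun T _ => ?_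
            rw [Finset.sum_filter]
      _ = ∑ c ∈ C, ∑ T ∈ SH, if Tc c = T then ((idx T : ℂ)⁻¹ * ((m T : ℂ))⁻¹) * (idx T : ℂ) else 0 := Finset.sum_comm
      _ = ∑ c ∈ C, ((idx (Tc c) : ℂ)⁻¹ * ((m (Tc c) : ℂ))⁻¹) * (idx (Tc c) : ℂ) := by
            refine Finset.sum_congr rfl fun c hc => ?_
            rw [Finset.sum_ite_eq SH (Tc c), if_pos (hTc c hc)]
      _ = ∑ c ∈ C, ((C.card : ℂ))⁻¹ := by
            refine Finset.sum_congr rfl fun c hc => ?_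
            have h0 : (idx (Tc c) : ℂ) ≠ 0 := Nat.cast_ne_zero.2 (hidx c hc)
            rw [hmC c hc, mul_assoc, mul_comm ((C.card : ℂ))⁻¹, ← mul_assoc, inv_mul_cancel₀ h0, one_mul]
      _ = 1 := by
            rw [Finset.sum_const, nsmul_eq_mul, mul_inv_cancel₀]
            exact Nat.cast_ne_zero.2 hCpos.ne'
  -- §d  Assemble.
  symm
  calc ∑ T ∈ SH, ((idx T : ℂ)⁻¹ * ((m T : ℂ))⁻¹) * ∑ i : Fin (n T), ∑ x ∈ fib T i, F x
      = ∑ T ∈ SH, ((idx T : ℂ)⁻¹ * ((m T : ℂ))⁻¹) *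
          ∑ q ∈ Q, F q * ((((Finset.univ : Finset (Fin (n T))).biUnion (fib T)).filter (fun x => st x q)).card : ℂ) := by
          refine Finset.sum_congr rfl fun T hT => ?_
          rw [hsumA T hT, hsumQ T hT]
    _ = ∑ T ∈ SH, ∑ q ∈ Q, F q * (((idx T : ℂ)⁻¹ * ((m T : ℂ))⁻¹) *
          ((((Finset.univ : Finset (Fin (n T))).biUnion (fib T)).filter (fun x => st x q)).card : ℂ)) := by
          refine Finset.sum_congr rfl fun T _ => ?_
          rw [Finset.mul_sum]
          refine Finset.sum_congr rfl fun q _ => ?_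
          ring
    _ = ∑ q ∈ Q, ∑ T ∈ SH, F q * (((idx T : ℂ)⁻¹ * ((m T : ℂ))⁻¹) *
          ((((Finset.univ : Finset (Fin (n T))).biUnion (fib T)).filter (fun x => st x q)).card : ℂ)) := Finset.sum_comm
    _ = ∑ q ∈ Q, F q := by
          refine Finset.sum_congr rfl fun q hq => ?_
          rw [← Finset.mul_sum, hcount q hq, mul_one]

end Literature.GroupTheory.StableFibre
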